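import Summits.Ventures.QEC.Thresholds.RotatedSurfaceCodeSAWThresholds
import Summits.Ventures.QEC.Thresholds.PlanarSurfaceCodeSAWInhomogeneous
import Literature.InformationTheory.QuantumCodes.RotatedSurfaceCodeCrossingPathsInhomogeneous
import HarnessLib

/-!
# Rotated surface codes `RSC(L)`, code capacity with INHOMOGENEOUS independent noise (`H_X` sector): every family of
# qubit-dependent rates `p_{i,v} ≤ ρ < p₀(2.6939)` (in particular `ρ ≤ .0357`) is below threshold — unconditional, KERNEL

Venture QEC, `Summits/Ventures/QEC/Thresholds/` (LADDER-QEC rung Q5, PARTITION row 09; qec-type-09 gen 6, cell item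
«09.RSCINH»; the rotated twin of `PlanarSurfaceCodeSAWInhomogeneous.lean`, item 135 (D)). Item 144
(`RotatedSurfaceCodeSAWThresholds.lean`) certifies `p_c ≥ p₀(2.6939) > .0357` for the `H_X` sector of the rotated surface codes
under i.i.d. flips. Realistic noise is inhomogeneous; with `RotatedSurfaceCodeCrossingPathsInhomogeneous.lean` (the odd
column-`0` residual bound for `indepWeight r`, rates `≤ ρ ≤ 1/2`) the same robustness statement holds for every independent
law whose rates are bounded by `ρ`:

| theorem | statement | tier |
|---|---|---|
| `rsc_inhom_belowThreshold_of_sawCountBound` | `cₙ ≤ C νⁿ`, rates `≤ ρ ≤ 1/2`, `4ν²ρ(1-ρ) < 1` ⇒ `Σ_{fails} w_r(e) → 0`, every minimum-weight decoder family of the `H_X` sector | CERTIFIED (kernel), parametric |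
| `rsc_inhom_belowThreshold_of_connectiveConstant_le` | `μ(ℤ²) ≤ μ'`, rates `≤ ρ < p₀(μ')` ⇒ `→ 0` | CERTIFIED (kernel), parametric |
| ★ `rsc_inhom_belowThreshold_kernelSymmK16`, `rsc_inhom_belowThreshold_0357` | rates `≤ ρ < p₀(2.6939)`, resp. `≤ ρ ≤ .0357` ⇒ `→ 0` | CERTIFIED (kernel), unconditional |

HONEST FRAMING: one sector (`H_X`, every `L`); a failure-SUM statement (the rates vary with the qubit), not a threshold VALUE;
certified at the kernel certificate `μ(ℤ²) ≤ 2.6939`. No `native_decide`, no named fact, axioms standard.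

## References

* [DennisEtAl2002] E. Dennis, A. Kitaev, A. Landahl, J. Preskill, *Topological quantum memory*, J. Math. Phys. 43 (2002)
  4452–4505, arXiv:quant-ph/0110143, §4.1 (independent errors), §5.3 eqs. (threshold_2d), (fail_2d) ("This change has no
  effect on the estimate of the threshold").
* [PonitzTittmann2000] A. Pönitz, P. Tittmann, Electron. J. Combin. 7 (2000) R21, Table 2 (`d = 2, k = 16`: `2.6939`).
-/

noncomputable section

namespace Summit.Ventures.QEC.Thresholds

open Filter Topology Finset Matrix
open Literature.InformationTheory.QuantumCodes
open Literature.InformationTheory.QuantumCodes.RotatedSurface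
open Literature.InformationTheory.QuantumCodes.ToricCode (SAWCountBound)
open Literature.Probability.RandomPlanarGeometry

open Classical in
/-- The inhomogeneous failure sum of a minimum-weight decoder of the `H_X` sector of `RSC(L)` (`L ≥ 1`) is at most the
inhomogeneous probability of an odd column-`0` residual. [cite: DennisEtAl2002, §5.2 (Prob_fail ≤ the probability of a non-trivial relative polygon)] -/
theorem rsc_inhom_failure_le_sum_oddResidual {L : ℕ} (hL : 0 < L)
    {D : Decoder (Fin (L + 1) × Fin (L - 1) → ZMod 2) (Fin L × Fin L → ZMod 2)}
    (hD : D.IsMinWeight (fun e => HX L *ᵥ e) {x | HX L *ᵥ x = 0} hammingNorm)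
    {r : Fin L × Fin L → ℝ} (hr0 : ∀ v, 0 ≤ r v) (hr1 : ∀ v, r v ≤ 1) :
    (∑ e ∈ univ.filter (fun e : Fin L × Fin L → ZMod 2 =>
        ¬ D.Corrects (fun e => HX L *ᵥ e) ((RotatedSurface.code L).rowSpZ : Set (Fin L × Fin L → ZMod 2)) e),
        indepWeight r (supp e)) ≤
      ∑ e ∈ univ.filter (fun e : Fin L × Fin L → ZMod 2 =>
        ∑ i : Fin L, (D (HX L *ᵥ e) + e) (i, ⟨0, hL⟩) = 1), indepWeight r (supp e) := by
  refine Finset.sum_le_sum_of_subset_of_nonneg (fun e he => ?_) fun e _ _ => indepWeight_nonneg hr0 hr1 _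
  rw [Finset.mem_filter] at he ⊢
  exact ⟨Finset.mem_univ _, rsc_oddResidual_of_not_corrects hL hD he.2⟩

open Classical in
/-- **Inhomogeneous noise below `4ν² ρ(1-ρ) < 1`** (given `cₙ ≤ C νⁿ`, `ν > 0`): for every minimum-weight decoder family of
the `H_X` sector of the rotated surface codes and every family of qubit-dependent flip rates `0 ≤ p_{i,v} ≤ ρ ≤ 1/2`, the
failure probability tends to `0`. [cite: DennisEtAl2002, §5.3 eq. (threshold_2d)] -/
theorem rsc_inhom_belowThreshold_of_sawCountBound {C ν : ℝ} (hν : 0 < ν) (hC : SAWCountBound C ν)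
    (D : ∀ i, Decoder (Fin (i + 1 + 1) × Fin (i + 1 - 1) → ZMod 2) (Fin (i + 1) × Fin (i + 1) → ZMod 2))
    (hD : ∀ i, (D i).IsMinWeight (rscCode i).zSyndrome ((rscCode i).kerX : Set _) hammingNorm)
    {rate : ∀ i, Fin (i + 1) × Fin (i + 1) → ℝ} {ρ : ℝ} (hr0 : ∀ i v, 0 ≤ rate i v) (hrρ : ∀ i v, rate i v ≤ ρ)
    (hρ0 : 0 ≤ ρ) (hρ : ρ ≤ 1 / 2) (h4 : 4 * ν ^ 2 * (ρ * (1 - ρ)) < 1) :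
    Tendsto (fun i => ∑ e ∈ univ.filter (fun e : Fin (i + 1) × Fin (i + 1) → ZMod 2 =>
        ¬ (D i).Corrects (rscCode i).zSyndrome ((rscCode i).rowSpZ : Set (Fin (i + 1) × Fin (i + 1) → ZMod 2)) e),
        indepWeight (rate i) (supp e)) atTop (𝓝 0) := by
  have ht := rsc_tendsto_sum_indepWeight_oddResidual hν hC D hD hr0 hrρ hρ0 hρ h4
  have hr1 : ∀ i v, rate i v ≤ 1 := fun i v => (hrρ i v).trans (by linarith)
  refine squeeze_zero' (Filter.Eventually.of_forall fun i => ?_)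
    (Filter.Eventually.of_forall fun i => rsc_inhom_failure_le_sum_oddResidual (by omega) (hD i) (hr0 i) (hr1 i)) ht
  exact Finset.sum_nonneg fun e _ => indepWeight_nonneg (hr0 i) (hr1 i) _

open Classical in
/-- **Inhomogeneous noise from any bound on the connective constant**: if `μ(ℤ²) ≤ μ'` (`μ' ≥ 1`) and all rates are
`≤ ρ < p₀(μ')`, the failure probability of every minimum-weight decoder family of the `H_X` sector tends to `0`.
[cite: DennisEtAl2002, §5.3 eqs. (saw_2), (threshold_2d)] -/
theorem rsc_inhom_belowThreshold_of_connectiveConstant_le {μ' : ℝ} (hμ'1 : 1 ≤ μ')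
    (hμ : SAW.Zd.connectiveConstant 2 ≤ μ')
    (D : ∀ i, Decoder (Fin (i + 1 + 1) × Fin (i + 1 - 1) → ZMod 2) (Fin (i + 1) × Fin (i + 1) → ZMod 2))
    (hD : ∀ i, (D i).IsMinWeight (rscCode i).zSyndrome ((rscCode i).kerX : Set _) hammingNorm)
    {rate : ∀ i, Fin (i + 1) × Fin (i + 1) → ℝ} {ρ : ℝ} (hr0 : ∀ i v, 0 ≤ rate i v) (hrρ : ∀ i v, rate i v ≤ ρ)
    (hρ0 : 0 ≤ ρ) (hρ : ρ < thresholdValue μ') :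
    Tendsto (fun i => ∑ e ∈ univ.filter (fun e : Fin (i + 1) × Fin (i + 1) → ZMod 2 =>
        ¬ (D i).Corrects (rscCode i).zSyndrome ((rscCode i).rowSpZ : Set (Fin (i + 1) × Fin (i + 1) → ZMod 2)) e),
        indepWeight (rate i) (supp e)) atTop (𝓝 0) := by
  obtain ⟨ν, hν, h4⟩ := exists_gt_four_mul_sq_lt_one_of_lt_thresholdValue hμ'1 hρ0 hρ
  obtain ⟨C, hC⟩ := exists_sawCountBound_of_connectiveConstant_lt (lt_of_le_of_lt hμ hν)
  exact rsc_inhom_belowThreshold_of_sawCountBound (by linarith) hC D hD hr0 hrρ hρ0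
    (hρ.le.trans (thresholdValue_le_half μ')) h4

open Classical in
/-- ★ **Rotated surface codes are below threshold under EVERY inhomogeneous independent noise with rates `≤ ρ < p₀(2.6939)`**
(`H_X` sector, every minimum-weight decoder family, every size) — UNCONDITIONAL, tier CERTIFIED (kernel).
[cite: DennisEtAl2002, §5.3 eq. (threshold_2d)] [cite: PonitzTittmann2000, Table 2 (d = 2, k = 16)] -/
theorem rsc_inhom_belowThreshold_kernelSymmK16
    (D : ∀ i, Decoder (Fin (i + 1 + 1) × Fin (i + 1 - 1) → ZMod 2) (Fin (i + 1) × Fin (i + 1) → ZMod 2))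
    (hD : ∀ i, (D i).IsMinWeight (rscCode i).zSyndrome ((rscCode i).kerX : Set _) hammingNorm)
    {rate : ∀ i, Fin (i + 1) × Fin (i + 1) → ℝ} {ρ : ℝ} (hr0 : ∀ i v, 0 ≤ rate i v) (hrρ : ∀ i v, rate i v ≤ ρ)
    (hρ0 : 0 ≤ ρ) (hρ : ρ < thresholdValue 2.6939) :
    Tendsto (fun i => ∑ e ∈ univ.filter (fun e : Fin (i + 1) × Fin (i + 1) → ZMod 2 =>
        ¬ (D i).Corrects (rscCode i).zSyndrome ((rscCode i).rowSpZ : Set (Fin (i + 1) × Fin (i + 1) → ZMod 2)) e),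
        indepWeight (rate i) (supp e)) atTop (𝓝 0) :=
  rsc_inhom_belowThreshold_of_connectiveConstant_le (by norm_num) SAW.Zd.connectiveConstant_two_le_26939 D hD hr0 hrρ hρ0 hρ

open Classical in
/-- Decimal form: **all rates `≤ ρ ≤ .0357` ⇒ failure probability `→ 0`** (rotated surface codes, `H_X` sector, every
minimum-weight decoder family) — UNCONDITIONAL, tier CERTIFIED (kernel). [cite: DennisEtAl2002, §5.3 eq. (p_c_2d)] -/
theorem rsc_inhom_belowThreshold_0357
    (D : ∀ i, Decoder (Fin (i + 1 + 1) × Fin (i + 1 - 1) → ZMod 2) (Fin (i + 1) × Fin (i + 1) → ZMod 2))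
    (hD : ∀ i, (D i).IsMinWeight (rscCode i).zSyndrome ((rscCode i).kerX : Set _) hammingNorm)
    {rate : ∀ i, Fin (i + 1) × Fin (i + 1) → ℝ} {ρ : ℝ} (hr0 : ∀ i v, 0 ≤ rate i v) (hrρ : ∀ i v, rate i v ≤ ρ)
    (hρ0 : 0 ≤ ρ) (hρ : ρ ≤ 0.0357) :
    Tendsto (fun i => ∑ e ∈ univ.filter (fun e : Fin (i + 1) × Fin (i + 1) → ZMod 2 =>
        ¬ (D i).Corrects (rscCode i).zSyndrome ((rscCode i).rowSpZ : Set (Fin (i + 1) × Fin (i + 1) → ZMod 2)) e),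
        indepWeight (rate i) (supp e)) atTop (𝓝 0) :=
  rsc_inhom_belowThreshold_kernelSymmK16 D hD hr0 hrρ hρ0 (lt_of_le_of_lt hρ thresholdValue_26939_bounds.1)

end Summit.Ventures.QEC.Thresholds
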